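import Summits.HodgeConjecture.HodgeConjecture.Theorems.F0P3cDbTThetaLiftMemberOfTheta   -- ★ p848566 (LH10-p02): the (O1) organ vocabulary (`MemXiFamily`, `ThetaTypeAtCM`, `xThetaCM`, DICT1∕DICT2 tokens) through its imports
import Summits.HodgeConjecture.HodgeConjecture.Theorems.F0P2oThetaClassOfSupercuspidal     -- ★ `thetaTypeAtCM_comap_mk_piH`, `isSupercuspidal_comap_mk_piH` (the CM-theta class `⟦πH ∘ localPiEquiv_v⁻¹⟧`)
import Summits.HodgeConjecture.HodgeConjecture.Theorems.F0P2oXThetaOwnClass                -- ★ K1c `isIrreducible_xThetaCM` ∕ `isSmooth_xThetaCM` (to FORM the class in the statement)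
import HarnessLib

/-!
# Crux `H413`, line LH10 «(D-b)ᵀ» — (O1♮-RED): THE ROAD-NEUTRAL CORE PEEL `stubThetaLiftMember_of_thetaComponent : ‹O1♮› → ‹O1›` of the organ (O1)
# «Π(ξ)-MEMBER WITH PRESCRIBED SUPERCUSPIDAL CM-THETA CLASS AT A NON-SPLIT PLACE» of `Cruxes/H413/Lines/F0_P3c_DbTPaydown.lean` (ED. 4, commit 4eb6ccd20407)

Cell `hodgecm-mathlib` (D-0151), FLOOR 0, crux item H413 = `stmt-HodgeConjecture-24833`; squad F0∕P3c line LH10, seat LH10-p01 (g2); DEAL (iii)′ «ROAD-NEUTRAL CORE OF (O1)»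
of LH10-plan (g0) 2026-09-02T03:19:28Z (LINE card item 4 «NEXT CUT (LH10-p01, ED. 5): road-neutral core O1♮ + ★ peel O1♮ → O1»).  THEOREMS ONLY (no `def`, no instance,
no notation, no named fact, no `sorry`); no `Cruxes/**` import (O50-1) — the organ text (O1) = `StubThetaLiftMember` of the tree leaf `Cruxes/H413/Lines/F0_P3c_DbTPaydown.lean`
:104–:133 (statement bytes unchanged since ED. 1, organ TYPE hash f8b533c39512828b) is RESTATED TOKEN FOR TOKEN as the conclusion; `--supports stmt-HodgeConjecture-24833`.
HONEST LABEL: HC_CM is proved only modulo the 7 printed citations (2 remaining: hLiu418 = stmt-HodgeConjecture-24832, h413 = stmt-HodgeConjecture-24833) until rung 0 closes;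
this file proves no letter — it REDUCES the print organ (O1) to the road-neutral core ‹O1♮› below, which carries NO theta-type predicate and NO supercuspidality of
constituents: only «which class».

THE REDUCTION.  ‹O1♮› («Π(ξ)-MEMBER WHOSE `v`-CONSTITUENTS ARE THE CM-THETA CLASS»): for the (O1) prefix binders VERBATIM (CM frame `(L, H)`, Rogawski's `μω` with
`μω|_{𝕀_{L⁺}} = ω_{L∕L⁺}`, a rational theta frame `(e₁, dV, g)`, `ξ`, a pair `(μ, χ_f)` with `χ_f` continuous and unitary on the two DICTIONARY equations DICT1∕DICT2) and a
non-split finite `v` of `L⁺`, THERE ARE a global line `ε ∈ (L⁺)ˣ`, an automorphic measure `μA` and a DISCRETE automorphic `P` of `U(H)(𝔸_{L⁺})` with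
(i) `MemXiFamily P hH hHd μω hμu ξ` (D6 envelope ★ `GlobalAPacketMembership`), (ii) Liu's local theta type `X_v(μ, ε, χ_f)` (★ `xThetaCM`) SUPERCUSPIDAL,
(iii) `P` has a `v`-constituent, (iv) EVERY `v`-constituent `c` of `P` IS the CM-theta class `⟦(X_v(μ, ε, χ_f) ∘ κ_g⁻¹) ∘ localPiEquiv_v⁻¹⟧ ∈ Irr(U(H)(L⁺_v))` — the SUBJECT of ★
`F0P2oThetaClassOfSupercuspidal.thetaTypeAtCM_comap_mk_piH` (the class is FORMED in the statement from ★ K1c `isIrreducible_xThetaCM` ∕ `isSmooth_xThetaCM` at the named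
hypotheses `hχc`, `hχn`; purely LOCAL at `v`: no `Chi`, no `rhoAtLine`, no frame transport `ιV`).  PROOF of (O1) from it: substitute (iv) into each constituent; supercuspidality
of the class is ★ `isSupercuspidal_comap_mk_piH` fed with (ii), and `ThetaTypeAtCM … ε v ⟦…⟧` is ★ `thetaTypeAtCM_comap_mk_piH` (isotypic read-back ★ `IrrClass.comap_comap_symm` +
★ `F0P2iThetaTypeCriterion`).  PRINT READING of ‹O1♮› (both roads, as for (O1)): ROAD B [Rogawski1990 §13.3 Thm. 13.3.7 pp. 202–203 + §14.6 pp. 242–245: a DISCRETE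
`Π(ξ)`-member on `U(H)` with `P_v ≅ πˢ(ξ_v)` (even `πˢ`-set: `v` and one more inert place); §13.1 Prop. 13.1.3 (d) p. 199: `πˢ` supercuspidal] + [GelbartRogawski1991 §5.1
Lem. 5.1.2 p. 466 (local ingredient), §5.2 Cor. 5.2.2 p. 467: `πˢ(ξ_v) ∘ e` IS the CM-theta class when DICT1∕DICT2 tie `(μ, χ_f)` to `ξ` at `v`] — true ON AND OFF the automorphic
locus of `χ_f`; ROAD A (tree, automorphic weight-one locus only) = ★ Θ-OCC-GEN `F0P2tThetaOccursInGenNeg.thetaOccursInGen` + ★ (WAᴸ) p848259∕p848354 + ★ (SCᴸ) p848292 + ★ (TCᴸ)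
p848434 §1 (`eq_thetaClass_of_isConstituentOf` lands EXACTLY on clause (iv)) + ★ S2♯-θ — cf. ★ p848642 `F0P3cDbTThetaOccurrenceLiuLocus` (LH10-p02), which pays (O1) on that locus.
WHY ROAD-NEUTRAL: clause (iv) names the class but asserts neither its theta type nor its supercuspidality as a constituent property — both are ★ theorems about the class; so any
road producing a member with the right `v`-class (trace formula, theta lift of any archimedean type, or a future LOCALITY + globalisation road) feeds (O1) through this peel.

## References
* [GelbartRogawski1991] S. Gelbart, J. Rogawski, Invent. Math. 105 (1991): §3.4 Prop. 3.4.1 pp. 459–460, Thm. 3.4 (a) p. 461; §5.1 (5.1.1) p. 465, Lem. 5.1.2 p. 466; §5.2 Cor. 5.2.2 p. 467.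
* [Rogawski1990] J. Rogawski, Ann. of Math. Stud. 123 (1990): §13.1 Prop. 13.1.3 (d) p. 199; §12.2 (2) p. 174; §13.3 Thm. 13.3.7 pp. 202–203; §14.6 pp. 242–245.
* [Liu2021] Y. Liu, Camb. J. Math. 9 (2021): Def. 4.11 (l. 2090–2096) (the local theta type `X_v(μ, ε, χ)`).
* [BushnellHenniart2006] C. Bushnell, G. Henniart, Grundlehren 335: §1.1, §2 (classes, constituents).  [HarishChandra1970] LNM 162, Part I §3 p. 9 (supercuspidal).
-/

set_option autoImplicit false
-- the mandated namespace repeats the single-problem summit's segment (`HodgeConjecture.HodgeConjecture`)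
set_option linter.dupNamespace false

noncomputable section

open scoped Matrix Kronecker MatrixGroups MonoidAlgebra ComplexOrder
open NumberField NumberField.InfinitePlace IsDedekindDomain MeasureTheory
open Literature.NumberTheory Literature.NumberTheory.Automorphic Literature.NumberTheory.Automorphic.UnitaryGroup
open Literature.NumberTheory.Automorphic.Liu2021 Literature.NumberTheory.Automorphic.Liu2021.AppendixC
open Literature.NumberTheory.Automorphic.Liu2021.Def411WeilCarriers
open Literature.NumberTheory.Automorphic.Liu2021.Def411WeilCarriersDoubling
open Literature.NumberTheory.Automorphic.Liu2021.CheckOfChi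
open Literature.NumberTheory.Automorphic.IdeleClassGroup
open Literature.NumberTheory.GelbartRogawski1991 Literature.NumberTheory.GelbartRogawski1991.UnitaryDualPair
open Literature.NumberTheory.GelbartRogawski1991.UnitaryDualPair.WeilCoinv
open Literature.NumberTheory.GelbartRogawski1991.UnitaryDualPair.LocalSplitting
open Literature.RepresentationTheory Literature.RepresentationTheory.Liu2021
open Literature.NumberTheory.GaloisRepresentations Literature.RepresentationTheory.HarrisKudlaSweet1996
open Literature.NumberTheory.Rogawski1990
open Summit.HodgeConjecture.CorCM
open Summit.HodgeConjecture.CorCM.Transposition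
open Summit.HodgeConjecture.HodgeConjecture.Cruxes.H413

namespace Summit.HodgeConjecture.HodgeConjecture.Cruxes.H413.F0P3cDbTThetaLiftMemberOfThetaComponent

set_option synthInstance.maxHeartbeats 400000 in
set_option maxHeartbeats 16000000 in
/-- **(O1♮-RED) — THE PEEL `‹O1♮› → ‹O1›`.**  HYPOTHESIS ‹O1♮› «Π(ξ)-member whose `v`-constituents are the CM-theta class»: for the (O1) prefix binders (named `hχc`, `hχn`) and a
non-split `v`, some global line `ε`, some automorphic measure `μA` and some discrete `P` with `MemXiFamily P hH hHd μω hμu ξ`, `X_v(μ, ε, χ_f)` supercuspidal, a `v`-constituent, and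
every `v`-constituent EQUAL to the CM-theta class `⟦(X_v(μ, ε, χ_f) ∘ κ_g⁻¹) ∘ localPiEquiv_v⁻¹⟧`.  CONCLUSION = the organ (O1) `StubThetaLiftMember` of
`Cruxes/H413/Lines/F0_P3c_DbTPaydown.lean` :104–:133 TOKEN FOR TOKEN (`∃ ε μA P`, `MemXiFamily`, a `v`-constituent exists, every `v`-constituent supercuspidal of theta type
`X_v(μ, ε, χ_f) ∘ κ_v⁻¹`).  Proof: rewrite each constituent to the class (clause (iv)); ★ `isSupercuspidal_comap_mk_piH`, ★ `thetaTypeAtCM_comap_mk_piH`.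
[cite: GelbartRogawski1991, §5.1 (5.1.1) p. 465, Lem. 5.1.2 p. 466; §5.2 Cor. 5.2.2 p. 467; §3.4 Thm. 3.4 (a) p. 461] [cite: Rogawski1990, §13.3 Thm. 13.3.7 pp. 202–203; §13.1 Prop. 13.1.3 (d) p. 199; §14.6 pp. 242–245]
[cite: Liu2021, Def. 4.11 (l. 2090–2096)] -/
theorem stubThetaLiftMember_of_thetaComponent
    (hcore :
      ∀ (L : Type) [Field L] [NumberField L] [IsCMField L] (H : Matrix (Fin 3) (Fin 3) L)
        (hH : (H.map (cmConjRingHom L))ᵀ = H) (hHd : IsUnit H.det) (μω : HeckeCharacter L) (hμu : μω.IsUnitary),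
        (∀ x : Literature.NumberTheory.GaloisRepresentations.ideleGroup ↥(maximalRealSubfield L),
          μω (AdeleRing.ideleBaseChange (↥(maximalRealSubfield L)) L x) = quadraticHeckeCharCM L x) →
        ∀ {n' : ℕ} (e₁ : Fin 3 × Fin 1 ≃ Fin n') (dV : Fin 3 → L) (hdV : ∀ i, IsCMField.complexConj L (dV i) = dV i) (hdV0 : ∀ i, dV i ≠ 0)
          (g : GL (Fin 3) L) (hg : ((g : Matrix (Fin 3) (Fin 3) L).map (cmConjRingHom L))ᵀ * H * (g : Matrix (Fin 3) (Fin 3) L) = Matrix.diagonal dV)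
          (ξ : OneDimAutRepH L)
          (μ : Literature.NumberTheory.Automorphic.IdeleClassGroup L →ₜ* Circle) (hμ : IsConjugateSymplectic L μ)
          (χf : UnitaryGroup.finAdelicOne (↥(maximalRealSubfield L)) L (IsCMField.complexConj L) →* ℂˣ),
          ∀ (hχc : Continuous χf) (hχn : ∀ z, ‖((χf z : ℂˣ) : ℂ)‖ = 1),
          (∀ v : HeightOneSpectrum (𝓞 ↥(maximalRealSubfield L)),
              (toHeckeCharacter L μ).semilocalComponent L v = (ξ.bcη⁻¹ * ξ.bcψ⁻¹ * μω).semilocalComponent L v) →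
          (∀ z : (FiniteAdeleRing (𝓞 L) L)ˣ,
              χf (finAdelicCheck (↥(maximalRealSubfield L)) L (IsCMField.complexConj L)
                  (AlgEquiv.ext fun x => by rw [AlgEquiv.mul_apply, IsCMField.complexConj_apply_apply, AlgEquiv.one_apply]) z) =
                (ξ.bcψ⁻¹ * (ξ.bcη⁻¹ * ξ.bcψ⁻¹ * μω) ^ 2)
                  (Units.map (N := AdeleRing (𝓞 L) L) (MonoidHom.inr (InfiniteAdeleRing L) (FiniteAdeleRing (𝓞 L) L)) z)) →
          ∀ (v : HeightOneSpectrum (𝓞 ↥(maximalRealSubfield L))), (∀ w : PlacesOver L v, IsCMField.complexConj L • w.1 = w.1) →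
            ∃ (ε : (↥(maximalRealSubfield L))ˣ)
              (μA : Measure (adelicGroupData (↥(maximalRealSubfield L)) L (IsCMField.complexConj L) 3 H).automorphicQuotient)
              (_ : (adelicGroupData (↥(maximalRealSubfield L)) L (IsCMField.complexConj L) 3 H).IsAutomorphicMeasure μA)
              (P : DiscreteAutomorphicRep (adelicGroupData (↥(maximalRealSubfield L)) L (IsCMField.complexConj L) 3 H) μA),
              MemXiFamily P hH hHd μω hμu ξ ∧
              (xThetaCM L e₁ dV hdV hdV0 μ hμ χf ε v).IsSupercuspidal ∧
              (∃ c : IrrClass ((cmDatum L 3 H).Local v),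
                (IrrClass.comap (localPiEquiv L (IsCMField.complexConj L) 3 H v) c).IsConstituentOf
                  (P.finRep.smoothPart.toRepresentation.comp (inclPlace (↥(maximalRealSubfield L)) L (IsCMField.complexConj L) 3 H v))) ∧
              ∀ c : IrrClass ((cmDatum L 3 H).Local v),
                (IrrClass.comap (localPiEquiv L (IsCMField.complexConj L) 3 H v) c).IsConstituentOf
                    (P.finRep.smoothPart.toRepresentation.comp (inclPlace (↥(maximalRealSubfield L)) L (IsCMField.complexConj L) 3 H v)) →
                  c = IrrClass.comap (localPiEquiv L (IsCMField.complexConj L) 3 H v).symm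
                    (IrrClass.mk
                      { V := _,
                        ρ := ((xThetaCM L e₁ dV hdV hdV0 μ hμ χf ε v :
                              localPi L (IsCMField.complexConj L) 3 (Matrix.diagonal dV) v →* _).comp
                            (localCongr L (IsCMField.complexConj L) g one_ne_zero
                              (by rw [one_smul]; exact hg) v).symm.toMulEquiv.toMonoidHom),
                        isIrreducible := F0P2oThetaTypeOwnClass.isIrreducible_piH L H e₁ dV hdV hdV0 g hg μ hμ χf ε v
                          (F0P2oXThetaOwnClass.isIrreducible_xThetaCM L e₁ dV hdV hdV0 μ hμ χf hχc hχn ε v),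
                        isSmooth := F0P2oThetaTypeOwnClass.isSmooth_piH L H e₁ dV hdV hdV0 g hg μ hμ χf ε v
                          (F0P2oXThetaOwnClass.isSmooth_xThetaCM L e₁ dV hdV hdV0 μ hμ χf hχc hχn ε v) })) :
    ∀ (L : Type) [Field L] [NumberField L] [IsCMField L] (H : Matrix (Fin 3) (Fin 3) L)
      (hH : (H.map (cmConjRingHom L))ᵀ = H) (hHd : IsUnit H.det) (μω : HeckeCharacter L) (hμu : μω.IsUnitary),
      (∀ x : Literature.NumberTheory.GaloisRepresentations.ideleGroup ↥(maximalRealSubfield L),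
        μω (AdeleRing.ideleBaseChange (↥(maximalRealSubfield L)) L x) = quadraticHeckeCharCM L x) →
      ∀ {n' : ℕ} (e₁ : Fin 3 × Fin 1 ≃ Fin n') (dV : Fin 3 → L) (hdV : ∀ i, IsCMField.complexConj L (dV i) = dV i) (hdV0 : ∀ i, dV i ≠ 0)
        (g : GL (Fin 3) L) (hg : ((g : Matrix (Fin 3) (Fin 3) L).map (cmConjRingHom L))ᵀ * H * (g : Matrix (Fin 3) (Fin 3) L) = Matrix.diagonal dV)
        (ξ : OneDimAutRepH L)
        (μ : Literature.NumberTheory.Automorphic.IdeleClassGroup L →ₜ* Circle) (hμ : IsConjugateSymplectic L μ)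
        (χf : UnitaryGroup.finAdelicOne (↥(maximalRealSubfield L)) L (IsCMField.complexConj L) →* ℂˣ),
        Continuous χf → (∀ z, ‖((χf z : ℂˣ) : ℂ)‖ = 1) →
        (∀ v : HeightOneSpectrum (𝓞 ↥(maximalRealSubfield L)),
            (toHeckeCharacter L μ).semilocalComponent L v = (ξ.bcη⁻¹ * ξ.bcψ⁻¹ * μω).semilocalComponent L v) →
        (∀ z : (FiniteAdeleRing (𝓞 L) L)ˣ,
            χf (finAdelicCheck (↥(maximalRealSubfield L)) L (IsCMField.complexConj L)
                (AlgEquiv.ext fun x => by rw [AlgEquiv.mul_apply, IsCMField.complexConj_apply_apply, AlgEquiv.one_apply]) z) =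
              (ξ.bcψ⁻¹ * (ξ.bcη⁻¹ * ξ.bcψ⁻¹ * μω) ^ 2)
                (Units.map (N := AdeleRing (𝓞 L) L) (MonoidHom.inr (InfiniteAdeleRing L) (FiniteAdeleRing (𝓞 L) L)) z)) →
        ∀ (v : HeightOneSpectrum (𝓞 ↥(maximalRealSubfield L))), (∀ w : PlacesOver L v, IsCMField.complexConj L • w.1 = w.1) →
          ∃ (ε : (↥(maximalRealSubfield L))ˣ)
            (μA : Measure (adelicGroupData (↥(maximalRealSubfield L)) L (IsCMField.complexConj L) 3 H).automorphicQuotient)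
            (_ : (adelicGroupData (↥(maximalRealSubfield L)) L (IsCMField.complexConj L) 3 H).IsAutomorphicMeasure μA)
            (P : DiscreteAutomorphicRep (adelicGroupData (↥(maximalRealSubfield L)) L (IsCMField.complexConj L) 3 H) μA),
            MemXiFamily P hH hHd μω hμu ξ ∧
            (∃ c : IrrClass ((cmDatum L 3 H).Local v),
              (IrrClass.comap (localPiEquiv L (IsCMField.complexConj L) 3 H v) c).IsConstituentOf
                (P.finRep.smoothPart.toRepresentation.comp (inclPlace (↥(maximalRealSubfield L)) L (IsCMField.complexConj L) 3 H v))) ∧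
            ∀ c : IrrClass ((cmDatum L 3 H).Local v),
              (IrrClass.comap (localPiEquiv L (IsCMField.complexConj L) 3 H v) c).IsConstituentOf
                  (P.finRep.smoothPart.toRepresentation.comp (inclPlace (↥(maximalRealSubfield L)) L (IsCMField.complexConj L) 3 H v)) →
                c.IsSupercuspidal ∧ ThetaTypeAtCM L H e₁ dV hdV hdV0 g hg μ hμ χf ε v c
    := by
  intro L _ _ _ H hH hHd μω hμu hμω n' e₁ dV hdV hdV0 g hg ξ μ hμ χf hχc hχn hD1 hD2 v hns
  obtain ⟨ε, μA, hμA, P, hmem, hsc, hex, hall⟩ :=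
    hcore L H hH hHd μω hμu hμω e₁ dV hdV hdV0 g hg ξ μ hμ χf hχc hχn hD1 hD2 v hns
  refine ⟨ε, μA, hμA, P, hmem, hex, fun c hc => ?_⟩
  obtain rfl := hall c hc
  exact ⟨F0P2oThetaClassOfSupercuspidal.isSupercuspidal_comap_mk_piH L H e₁ dV hdV hdV0 g hg μ hμ χf ε v
      (F0P2oXThetaOwnClass.isIrreducible_xThetaCM L e₁ dV hdV hdV0 μ hμ χf hχc hχn ε v)
      (F0P2oXThetaOwnClass.isSmooth_xThetaCM L e₁ dV hdV hdV0 μ hμ χf hχc hχn ε v) hsc,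
    F0P2oThetaClassOfSupercuspidal.thetaTypeAtCM_comap_mk_piH L H e₁ dV hdV hdV0 g hg μ hμ χf ε v
      (F0P2oXThetaOwnClass.isIrreducible_xThetaCM L e₁ dV hdV hdV0 μ hμ χf hχc hχn ε v)
      (F0P2oXThetaOwnClass.isSmooth_xThetaCM L e₁ dV hdV hdV0 μ hμ χf hχc hχn ε v)⟩

end Summit.HodgeConjecture.HodgeConjecture.Cruxes.H413.F0P3cDbTThetaLiftMemberOfThetaComponent

end
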